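import Summits.ABC.IUTFork.DAGC312f
import Summits.ABC.IUTFork.Thm311LinkCompat
import Summits.ABC.IUTFork.DAGTopM

/-!
# Kernel DAG index — layer C312, part g: Theorem 3.11 AS A WHOLE (c312-1 file D) — nodes, the loci read through it, and the licence apex

index v1 · abc-iut-c312-2 (filer) per HOME/plan/KERNEL-DAG-SPEC.md v1.3 §2(b),(e), §4 (3). APPEND-ONLY design (new readings, new
apexes; nothing redefined). With c312-1's file D `Thm311LinkCompat` (LANDED: `LinkData.PartIIIa/b/c/d`, `FullSituation`,
`FullSituation.PartIII`, `FullSituation.Statement` = (i) ∧ (ii) ∧ (iii), `statement_iff`) the typed STATEMENT of [IUTchIII]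
Theorem 3.11 exists as one `Prop` over named signatures.

THIS FILE PROVES NOTHING NEW AND ASSERTS NOTHING.
* NODES (claim-form, spec §2(b); kernel_ids from plan/DAG.tsv): `N_IUTchIII_Thm3_11_i S := S.PartI`, `N_IUTchIII_Thm3_11_ii S :=
  S.PartII`, `N_IUTchIII_Thm3_11_iii S := S.PartIII`, `N_IUTchIII_Thm3_11 S := S.Statement` — NO `_holds` (disputed claims, never
  asserted); `N_IUTchIII_Thm3_11_iii_ab_part`: (iii)(a),(b) ARE theorems of the signature (c312-1 `partIIIa_holds`/`partIIIb_holds`: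
  squares of FULL poly-isomorphisms commute) — a `_part` witness, honestly partial.
* `lociReadingF S pending` — the 85 loci read through the FULL situation: (iii)(a)–(d) ↦ `PartIIIa/b/c`, `PartIIId ∧ EvalCompatUpToInd`;
  "the algorithm of Thm 3.11" ↦ `S.Statement` (complete now); everything else as `DAGC312f.lociReadingM S.toLatticeSituation`
  (so 27 of 85 knitted for the situation at hand); `lociReadingF_of_statement`: `S.Statement` + the V2 nodes grant every locus.
* APEXES: `summit_of_cor312_M_statement` — `ABC` from V, T, A, hInd, per curve a FULL situation with `Statement` (Thm 3.11 as
  typed), pilot nouns + admissibility + the two finiteness clauses, the V2-read rest, the twenty inferences, the (xi-f) reading,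
  the number identifications; and `summit_of_cor312_M_licence` — THE DISPUTE AS TWO NAMED HYPOTHESES: `hThm : Statement` (Theorem
  3.11 as the author states it) and `hLicOfThm : Statement → componentwise QSubHull` (THAT Theorem 3.11 licenses Step (xi-f) —
  affirmed by the author, p. 184 "then follows formally"; denied by Scholze–Stix §2.2; replaced by (9-1) by LANA §9) — no chain, no
  opaque loci: kernel_hyps = 8 (hInd, hadm, hreal, hqreal, hThm, hLicOfThm, hΘ, hq).
HONEST FRAMING: nothing here asserts that abc is proved or refuted or takes a side on Cor. 3.12. typed ≠ discharged; indexed ≠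
endorsed. [claim: Mochizuki2012, status: disputed]
-/

noncomputable section

namespace Summit.ABC.IUTFork.DAG

open Cor312Proof Thm311

/-! ## 1. Theorem 3.11 nodes (claim-form) -/

/-- [node IUTchIII:Thm3.11(i) · C312 · [IUTchIII] Thm 3.11 (i), kurims pp.153–155 · c312-1 B p404064 · claim-form] `Situation.PartI`
= "splitting monoids in the sub-packets" ∧ degree clause (c) ∧ multiradial compatibility up to (Ind1), (Ind2). NO witness.
[claim: Mochizuki2012, status: disputed] -/
abbrev N_IUTchIII_Thm3_11_i {T : ThetaIndex} (S : Situation T) : Prop := S.PartI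

/-- [node IUTchIII:Thm3.11(ii) · C312 · [IUTchIII] Thm 3.11 (ii), kurims pp.155–156 · c312-1 C p404703/p405020 · claim-form]
`LatticeSituation.PartII` = for every column: Kummer (a), (b), (c), mutual compatibility, (Ind3), log-volume clause. NO witness.
[claim: Mochizuki2012, status: disputed] -/
abbrev N_IUTchIII_Thm3_11_ii {T : ThetaIndex} (S : LatticeSituation T) : Prop := S.PartII

/-- [node IUTchIII:Thm3.11(iii) · C312 · [IUTchIII] Thm 3.11 (iii), kurims pp.156–158 · c312-1 D (tree) · claim-form]
`FullSituation.PartIII` = (a) ∧ (b) ∧ (c) ∧ (d) ∧ the final evaluation-compatibility clause. NO `_holds`.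
[claim: Mochizuki2012, status: disputed] -/
abbrev N_IUTchIII_Thm3_11_iii {T : ThetaIndex} (S : FullSituation T) : Prop := S.PartIII

/-- [node IUTchIII:Thm3.11 · C312 · [IUTchIII] Thm 3.11 (whole), kurims pp.153–158 · c312-1 A–D · claim-form] `FullSituation.Statement`
= (i) ∧ (ii) ∧ (iii). NO witness — the disputed theorem as typed, never asserted. [claim: Mochizuki2012, status: disputed] -/
abbrev N_IUTchIII_Thm3_11 {T : ThetaIndex} (S : FullSituation T) : Prop := S.Statement

/-- partial witness of `N_IUTchIII_Thm3_11_iii`: (iii)(a) and (iii)(b) ARE theorems of the signature (c312-1: a square whose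
horizontal sides are FULL poly-isomorphisms commutes), for every instantiation; (c), (d) and the final clause are not.
[claim: Mochizuki2012, status: disputed] -/
theorem N_IUTchIII_Thm3_11_iii_ab_part {T : ThetaIndex} (S : FullSituation T) : S.link.PartIIIa ∧ S.link.PartIIIb :=
  ⟨S.link.partIIIa_holds, S.link.partIIIb_holds⟩

/-! ## 2. The loci read through the full situation -/

/-- LOCI READING THROUGH THE FULL SITUATION (c312-1 A–D) on top of `lociReadingM`. [claim: Mochizuki2012, status: disputed] -/
def lociReadingF {T : ThetaIndex} (S : FullSituation T) (pending : Locus → Prop) (c : Locus) : Prop :=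
  match c with
  | .thm3_11_iii_a => S.link.PartIIIa
  | .thm3_11_iii_b => S.link.PartIIIb
  | .thm3_11_iii_c => S.link.PartIIIc
  | .thm3_11_iii_d => S.link.PartIIId ∧ S.EvalCompatUpToInd
  | .thm3_11_algo => S.Statement
  | c => lociReadingM S.toLatticeSituation pending c

variable {T : ThetaIndex} (S : FullSituation T) (pending : Locus → Prop)

/-- knitted: Thm 3.11 (iii)(a) ↦ `PartIIIa`. [folklore] -/
theorem lociReadingF_thm3_11_iii_a : lociReadingF S pending .thm3_11_iii_a = S.link.PartIIIa := rfl
/-- knitted: Thm 3.11 (iii)(b) ↦ `PartIIIb`. [folklore] -/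
theorem lociReadingF_thm3_11_iii_b : lociReadingF S pending .thm3_11_iii_b = S.link.PartIIIb := rfl
/-- knitted: Thm 3.11 (iii)(c) ↦ `PartIIIc`. [folklore] -/
theorem lociReadingF_thm3_11_iii_c : lociReadingF S pending .thm3_11_iii_c = S.link.PartIIIc := rfl
/-- knitted: Thm 3.11 (iii)(d) ↦ `PartIIId ∧ EvalCompatUpToInd` (the final clause of (c)/(d)). [folklore] -/
theorem lociReadingF_thm3_11_iii_d :
    lociReadingF S pending .thm3_11_iii_d = (S.link.PartIIId ∧ S.EvalCompatUpToInd) := rfl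
/-- knitted: "the algorithm of Thm 3.11" ↦ `FullSituation.Statement` (complete). [folklore] -/
theorem lociReadingF_thm3_11_algo : lociReadingF S pending .thm3_11_algo = S.Statement := rfl
/-- fall-through to `lociReadingM` (e.g. (ii)(a) ↦ `KummerA` of every column). [folklore] -/
theorem lociReadingF_thm3_11_ii_a :
    lociReadingF S pending .thm3_11_ii_a = lociReadingM S.toLatticeSituation pending .thm3_11_ii_a := rfl

/-- **The typed Theorem 3.11 grants every Theorem-3.11 locus of the reading** (the rest through the V2 nodes / `pending`).
[folklore] -/
theorem lociReadingF_of_statement (hS : S.Statement) (hV2 : ∀ c, lociReadingV2 pending c) :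
    ∀ c, lociReadingF S pending c := by
  intro c
  unfold lociReadingF
  split
  · exact hS.2.2.1
  · exact hS.2.2.2.1
  · exact hS.2.2.2.2.1
  · exact ⟨hS.2.2.2.2.2.1, hS.2.2.2.2.2.2⟩
  · exact hS
  · exact lociReadingM_of_parts S.toLatticeSituation pending hS.1 hS.2.1 hV2 _

/-! ## 3. Apexes -/

/-- **APEX, author's terms, Theorem 3.11 as typed granted.** `ABC` from V, T, A, hInd, per curve a full situation `S P` with
`(S P).Statement` (`hThm`), pilot nouns `Pn P` with admissibility (`hadm`) and the two finiteness clauses (`hreal`, `hqreal`), the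
V2-read remaining loci (`hV2`), the twenty inferences under the full reading (`hC`), the (xi-f) sentence read as Reading 1
(`hread`), the number identifications (`hΘ`, `hq`). kernel_hyps = 10 (hInd, hadm, hreal, hqreal, hThm, hV2, hC, hread, hΘ, hq;
the earlier count "9" omitted hV2 — referee abc-iut-ref-b PASS-B8 finding B8-2, docstring-only correction). [claim: Mochizuki2012, status: disputed] -/
theorem summit_of_cor312_M_statement (V : HeightFamily) (Tm : Thm110Family V) (A : AbcDictionary V)
    (hInd : MochizukiIndeterminacies Tm) {TI : V.Pt → ThetaIndex} (S : ∀ P, FullSituation (TI P))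
    (Pn : ∀ P, PilotNouns (S P).toLatticeSituation) (n m : ℤ)
    (hadm : ∀ P (j : (TI P).LabelStar) (vQ : (TI P).VQ), (Pn P).ComponentAdm n m j vQ)
    (hreal : ∀ P, (Pn P).NegLogThetaReal n m) (hqreal : ∀ P, (Pn P).NegLogQReal n m)
    (hThm : ∀ P, (S P).Statement) (pending : Locus → Prop) {O : Obs → Prop} (hV2 : ∀ c, lociReadingV2 pending c)
    (hC : ∀ P, Chain (lociReadingF (S P) pending) O)
    (hread : ∀ P (j : (TI P).LabelStar) (vQ : (TI P).VQ), O .constitutesConstruction →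
      ((Pn P).toCor312Setting n m j vQ (hadm P j vQ)).RepresentedVol)
    (hΘ : ∀ P, (Pn P).negLogTheta n m = (Tm.X P).negLogTheta) (hq : ∀ P, (Pn P).negLogQ n m = -(Tm.X P).absLogq) :
    _root_.ABC :=
  abc_of_indeterminacies_of_cor312 V Tm A hInd fun P => by
    have hc : (Pn P).Cor312At n m :=
      (Pn P).cor312At_of_componentwise n m (hadm P) (hreal P) (hqreal P)
        fun j vQ => setting_cor312_of_chain _ (lociReadingF_of_statement (S P) pending (hThm P) hV2) (hC P) (hread P j vQ)
    unfold Thm110Data.Cor312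
    rw [← hΘ, ← hq]
    exact hc.2.2

/-- **APEX, THE DISPUTE AS TWO NAMED HYPOTHESES.** `ABC` from V, T, A, hInd, per curve a full situation, pilot nouns, admissibility,
the two finiteness clauses, `hThm : (S P).Statement` — Theorem 3.11 AS THE AUTHOR STATES IT, typed — and `hLicOfThm : Statement →
(in every component, the q-pilot region lies in the holomorphic hull of the possible images)` — THAT Theorem 3.11 licenses Step
(xi-f) ([IUTchIII] p. 184 l. 26–29 "then follows formally"; denied by Scholze–Stix §2.2; replaced by (9-1) by LANA §9); number
identifications. No chain, no opaque loci. kernel_hyps = 8 (hInd, hadm, hreal, hqreal, hThm, hLicOfThm, hΘ, hq).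
[claim: Mochizuki2012, status: disputed] -/
theorem summit_of_cor312_M_licence (V : HeightFamily) (Tm : Thm110Family V) (A : AbcDictionary V)
    (hInd : MochizukiIndeterminacies Tm) {TI : V.Pt → ThetaIndex} (S : ∀ P, FullSituation (TI P))
    (Pn : ∀ P, PilotNouns (S P).toLatticeSituation) (n m : ℤ)
    (hadm : ∀ P (j : (TI P).LabelStar) (vQ : (TI P).VQ), (Pn P).ComponentAdm n m j vQ)
    (hreal : ∀ P, (Pn P).NegLogThetaReal n m) (hqreal : ∀ P, (Pn P).NegLogQReal n m)
    (hThm : ∀ P, (S P).Statement)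
    (hLicOfThm : ∀ P, (S P).Statement → ∀ (j : (TI P).LabelStar) (vQ : (TI P).VQ),
      ((Pn P).toCor312Setting n m j vQ (hadm P j vQ)).QSubHull)
    (hΘ : ∀ P, (Pn P).negLogTheta n m = (Tm.X P).negLogTheta) (hq : ∀ P, (Pn P).negLogQ n m = -(Tm.X P).absLogq) :
    _root_.ABC :=
  summit_of_cor312_M V Tm A hInd (fun P => (S P).toLatticeSituation) Pn n m hadm hreal hqreal
    (fun P j vQ => hLicOfThm P (hThm P) j vQ) hΘ hq

end Summit.ABC.IUTFork.DAG

end
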